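import Mathlib
import Summits.Schanuel.Schanuel.Theses.RigidCore

/-!
# Sketch — crux-ideate stmt-Schanuel-0969 (MinimalCounterexampleInAcl), ideator 1, round 1

First lemmas of the two idea cards (statements only; `sorry`-bodies are allowed in a sketch,
the point is that the signatures elaborate over existing declarations).
-/

noncomputable section

open Complex Set
open FirstOrder

namespace Summit.Schanuel.Schanuel.Cruxes.MinimalCounterexampleInAcl.Sketch

open Literature.NumberTheory.Transcendental
open Literature.ModelTheory.ExponentialFields

/-- The ℚ-locus mates of `x`: tuples `x'` that are ℚ-linearly independent and satisfy every
ℚ-polynomial relation of `(x, eˣ)` — i.e. the ℚ-linearly independent graph points on the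
ℚ-locus `W_x` of `(x, eˣ)` (written without naming `W_x`). -/
def locusMates {n : ℕ} (x : Fin n → ℂ) : Set (Fin n → ℂ) :=
  {x' | LinearIndependent ℚ x' ∧
    ∀ p : MvPolynomial (Fin n ⊕ Fin n) ℚ,
      MvPolynomial.aeval (Sum.elim x (cexp ∘ x)) p = 0 →
      MvPolynomial.aeval (Sum.elim x' (cexp ∘ x')) p = 0}

/-- First-failure counterexample at rank `n` (the crux's hypothesis bundle). -/
def IsFirstFailure {n : ℕ} (x : Fin n → ℂ) : Prop :=
  LinearIndependent ℚ x ∧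
  Algebra.trdeg ℚ ↥(IntermediateField.adjoin ℚ (range x ∪ range (cexp ∘ x))) < (n : Cardinal) ∧
  ∀ r < n, SchanuelRank r

/-! ## Card A — integer-quantifier isolation -/

/-- A1 (definable isolation for free): for a Zariski-closed `W ⊆ ℂⁿ × ℂⁿ` defined over the prime
field, the set of ℚ-LINEARLY INDEPENDENT graph points on `W` is ∅-definable in `ℂ_exp`
(ℤ = kernel stabiliser is ∅-definable, so "∃ m ∈ ℤⁿ∖0, Σ mᵢxᵢ = 0" is one formula). -/
theorem definable_indepGraphPoints (n : ℕ) (W : Set (Fin n ⊕ Fin n → ℂ))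
    (hW : IsDefinedOver (⊥ : Subfield ℂ) W) :
    (∅ : Set ℂ).Definable Language.expRing
      {x : Fin n → ℂ | LinearIndependent ℚ x ∧ Sum.elim x (cexp ∘ x) ∈ W} := by
  sorry

/-- A1' : the locus mates of any tuple form an ∅-definable set (W_x is defined over ℚ by
Hilbert's basis theorem: finitely many integer-coefficient equations). -/
theorem definable_locusMates {n : ℕ} (x : Fin n → ℂ) :
    (∅ : Set ℂ).Definable Language.expRing (locusMates x) := by
  sorry

/-- First-failure sparsity (the transfer target C⁺ of card A): the ℚ-locus of a first-failure
counterexample carries only finitely many ℚ-independent graph points. -/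
def FirstFailureSparsity : Prop :=
  ∀ (n : ℕ) (x : Fin n → ℂ), IsFirstFailure x → (locusMates x).Finite

/-- A2 (reduction): sparsity of first-failure loci implies the crux, with NO definable-isolation
or weak-CIT uniformity lemma. -/
theorem crux_of_firstFailureSparsity (h : FirstFailureSparsity) :
    Summit.Schanuel.Schanuel.Theses.RigidCore.MinimalCounterexampleInAcl := by
  sorry

/-- Branch finiteness at rank `n`: only finitely many kernel translates `x + 2πik` of a
first-failure counterexample are again locus mates of `x`. -/
def BranchFiniteness : Prop :=
  ∀ (n : ℕ) (x : Fin n → ℂ), IsFirstFailure x →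
    {k : Fin n → ℤ | (fun i => x i + 2 * ↑Real.pi * I * (k i : ℂ)) ∈ locusMates x}.Finite

/-- Y-sparsity: the set of EXPONENTIALS of the locus mates is finite. -/
def ExpImageFinite : Prop :=
  ∀ (n : ℕ) (x : Fin n → ℂ), IsFirstFailure x → ((fun x' => cexp ∘ x') '' locusMates x).Finite

/-- A3 (lex-selection in finite branch classes): with ℤ, ℕ (Lagrange) and the lexicographic order
on ℤⁿ ∅-definable, "x' is the j-th lex-smallest element of its 2πiℤⁿ-class inside
`locusMates x`" is one ∅-formula; hence branch finiteness plus finiteness of the exponential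
image already give the crux. -/
theorem crux_of_branchFiniteness_of_expImageFinite
    (hB : BranchFiniteness) (hY : ExpImageFinite) :
    Summit.Schanuel.Schanuel.Theses.RigidCore.MinimalCounterexampleInAcl := by
  sorry

/-! ## Card B — close the integer parameter, sweep the transcendental one -/

/-- B1 (THEOREM-candidate, all ranks): branch finiteness holds for every first-failure
counterexample, the transcendence bill being paid by the crux's own hypothesis `SC(<n)`. -/
theorem branchFiniteness : BranchFiniteness := by
  sorry

/-- B2 (log sector): a first-failure counterexample all of whose exponentials are algebraic has
only finitely many locus mates; … -/
theorem locusMates_finite_of_exp_algebraic {n : ℕ} (x : Fin n → ℂ) (hx : IsFirstFailure x)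
    (halg : ∀ i, IsAlgebraic ℚ (cexp (x i))) : (locusMates x).Finite := by
  sorry

/-- … hence (card A) every coordinate lies in a finite ∅-definable set: the crux HOLDS on the
sector of logarithms of algebraic numbers. -/
theorem crux_logSector {n : ℕ} (x : Fin n → ℂ) (hx : IsFirstFailure x)
    (halg : ∀ i, IsAlgebraic ℚ (cexp (x i))) (i : Fin n) :
    ∃ s : Set ℂ, s.Finite ∧ Set.Definable₁ (∅ : Set ℂ) Language.expRing s ∧ x i ∈ s := by
  sorry

/-- B0 (structure lemma, pure algebraic geometry — the sweep): `K` relatively algebraically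
closed in `ℂ`, `X ⊆ ℂⁿ` irreducible closed and defined over `K`, `ℓ ∈ ℂⁿ`, `c ≠ 0` with
`dim X ≤ trdeg_K K(ℓ, c)`; if infinitely many integer vectors `k` have `ℓ + ck ∈ X`, then `X`
contains a proper-codimension… precisely: there are `m < n` ℚ-linearly independent rational
forms `q₁ … q_m` and an integer point `k₀` such that the rational-direction affine subspace
`N = {z | ∀ j, q_j · z = q_j · (ℓ + c k₀)}` lies in `X` and contains `ℓ + ck` for infinitely many
of those `k` (m = 0 means `X = ℂⁿ`). -/
theorem structure_lemma (n d : ℕ) (K : IntermediateField ℚ ℂ)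
    (hK : ∀ w : ℂ, IsAlgebraic K w → w ∈ K)
    (X : Set (Fin n → ℂ)) (hXirr : IsIrreducibleClosed ℂ X)
    (hXdef : IsDefinedOver K.toSubfield X) (hXdim : zariskiDim ℂ X ≤ d)
    (ℓ : Fin n → ℂ) (c : ℂ) (hc : c ≠ 0)
    (ht : (d : Cardinal) ≤ Algebra.trdeg K ↥(IntermediateField.adjoin K (insert c (range ℓ))))
    (hD : {k : Fin n → ℤ | (fun i => ℓ i + c * (k i : ℂ)) ∈ X}.Infinite) :
    ∃ (m : ℕ) (q : Fin m → Fin n → ℚ) (k₀ : Fin n → ℤ), m < n ∧ LinearIndependent ℚ q ∧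
      (fun i => ℓ i + c * (k₀ i : ℂ)) ∈ X ∧
      {z : Fin n → ℂ | ∀ j, ∑ i, (q j i : ℂ) * z i = ∑ i, (q j i : ℂ) * (ℓ i + c * (k₀ i : ℂ))} ⊆ X ∧
      {k : Fin n → ℤ | (fun i => ℓ i + c * (k i : ℂ)) ∈ X ∧
        ∀ j, ∑ i, (q j i : ℂ) * (k i : ℂ) = ∑ i, (q j i : ℂ) * (k₀ i : ℂ)}.Infinite := by
  sorry

/-! ## Card C — span-growth dichotomy (submodularity of the predimension) -/

/-- C1 (pairwise span growth): two locus mates with different ℚ-spans jointly lose TWO degrees of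
transcendence: `trdeg ℚ(x, x', eˣ, eˣ') ≤ dim_ℚ span(x, x') − 2` (submodularity of `δ` plus
`SC(<n)` on the proper subspace `span x ∩ span x'`; tree: `GammaField.predim_sup_le`). -/
theorem span_growth_pair {n : ℕ} (x x' : Fin n → ℂ) (hx : IsFirstFailure x)
    (hx' : x' ∈ locusMates x)
    (hnew : ¬ (range x' ⊆ (Submodule.span ℚ (range x) : Set ℂ))) :
    Algebra.trdeg ℚ ↥(IntermediateField.adjoin ℚ
        (range x ∪ range x' ∪ (range (cexp ∘ x) ∪ range (cexp ∘ x')))) + 2 ≤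
      (Module.finrank ℚ ↥(Submodule.span ℚ (range x ∪ range x')) : Cardinal) := by
  sorry

/-- Bounded Schanuel defect ("ℂ_exp is Bays–Kirby-like"): the predimension is bounded below. -/
def BoundedDefect : Prop :=
  ∃ d : ℕ, ∀ (m : ℕ) (z : Fin m → ℂ), LinearIndependent ℚ z →
    (m : Cardinal) ≤ Algebra.trdeg ℚ ↥(IntermediateField.adjoin ℚ (range z ∪ range (cexp ∘ z))) + d

/-- C2 (bounded defect ⇒ bounded rank): under `BoundedDefect`, all locus mates of a first-failure
counterexample lie in ONE finite-dimensional ℚ-space (at most `d + 1` of them can be span-new). -/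
theorem mates_span_finite_of_boundedDefect (hBD : BoundedDefect) {n : ℕ} (x : Fin n → ℂ)
    (hx : IsFirstFailure x) :
    ∃ s : Finset ℂ, ∀ x' ∈ locusMates x, range x' ⊆ (Submodule.span ℚ (↑s : Set ℂ) : Set ℂ) := by
  sorry

/-- The finite-rank case (to be fed to card B's sweep + toric Mordell–Lang): mates confined to a
finite-dimensional ℚ-space are finitely many. -/
def FiniteRankCase : Prop :=
  ∀ (n : ℕ) (x : Fin n → ℂ), IsFirstFailure x →
    (∃ s : Finset ℂ, ∀ x' ∈ locusMates x, range x' ⊆ (Submodule.span ℚ (↑s : Set ℂ) : Set ℂ)) →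
    (locusMates x).Finite

/-- C3 (assembly of card C): bounded defect + the finite-rank case give the crux (via card A's
reduction `crux_of_firstFailureSparsity`). -/
theorem crux_of_boundedDefect (hBD : BoundedDefect) (hFR : FiniteRankCase) :
    Summit.Schanuel.Schanuel.Theses.RigidCore.MinimalCounterexampleInAcl := by
  sorry

end Summit.Schanuel.Schanuel.Cruxes.MinimalCounterexampleInAcl.Sketch

end
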